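import Summits.Ventures.QEC.Census.CertInfoSetOrbitFast
import Summits.Ventures.QEC.Census.CertTwoBlockShift
import HarnessLib

/-!
# Orbit-STABILIZED information sets: masked averaging + canonical lane families — definitions and checks
# (qec-search-4 g6; «orbit lane v2», companion `Census/CertInfoSetOrbitStabSound.lean`)

THE LANDED LANE (`Census/CertInfoSetOrbit*.lean`, qec-search-4 g4) averages, over a list of code automorphisms `σ_i`,
the number of support points of a logical `c` falling into the FREE set of a view, and replays ALL selections of
`≤ t_s` kernel-basis words of some view (`t_s = ⌊(d−1)·K/n⌋` for two-block codes: `C(K, ≤ t)` lanes, `K = dim ker H_syn`).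

THIS FILE adds two things.
1. MASKED AVERAGING: the multiplicities are counted with respect to an arbitrary column set `F_s ⊇ free_s` per view
   (bitmask `M_s`; checks `multTabOKM` / `orbitProfileOKM`, same profile recursion `profGo`), and the per-view obligation
   becomes the abstract `MaskCovers n Hsyn Hstab wmax M t`: «every non-trivial logical with `≤ t` support points in `F`
   has weight `> wmax`».  The landed replay discharges it for `M = freeMask` (`maskCovers_of_reaches`, Sound file).
2. STABILIZED VIEWS (`StabView`, check `stabOK`): `F` is a union of orbits of a subgroup `H` of the automorphisms
   (labels `orb`, one mover word per `F`-column `x` mapping `x` to the BASE POINT `base[orb x] ∈ free` of its orbit,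
   preserving `F` and the labels).  Then a logical `z` with `1 ≤ |supp z ∩ F| ≤ t` has an `H`-translate `z'` of the
   same weight, still a non-trivial logical, whose free support CONTAINS the base point `b_j` of the first orbit `j` met
   by `supp z ∩ F` and otherwise only free columns of orbits `≥ j`: `z' = γ_{b_j} ⊕ (≤ t − 1 words of canonRows j)` — a
   forced-top-row family of qec-type-01's lane engine (`TopReaches`, `Plane.topReaches_of_seg[2]`, qec-type-01
   `Census/CertTwoBlockShift.lean`).  Cost `Σ_j C(|canonCols j|, ≤ t−1) ≈ C(K, ≤ t)/|H|` instead of `C(K, ≤ t)`.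
   (`maskCovers_of_stab`, Sound file.)  For two-block codes `|H| = 3 … 14` is typical (the obstruction to larger `H`
   is that `ker H_syn` must embed `H`-equivariantly into `𝔽₂^F`, and `|F| < 7n/12` at `d = 12`).

HONEST FRAMING: infrastructure — no certificate is read and no distance is asserted here; tier KERNEL, axioms
⊆ {propext, Classical.choice, Quot.sound}, no `native_decide`.  [folklore] (automorphism reduction of minimum-weight
enumeration as in Grassl 2006 §2.2; the canonical form «first orbit met contains its base point» is the free-action
special case).  Reuses by name: qec-search-7 `InfoSetCert` / `kerVec`, qec-type-12 `AutGen` / `wordPerm` / `wordApplyL`,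
qec-type-01 `TopReaches`, qec-search-4 g4 `OrbitView` / `profGo` / `countMasks`.
-/

set_option autoImplicit false

namespace Summit.Ventures.QEC.Census

open Matrix Literature.InformationTheory.QuantumCodes

/-! ## 1. Masked multiplicities and the masked profile check -/

/-- The transported masks `σ_w(M)` of one view, one per word (type-12 `wordApplyL`, one pass per letter). (definition) -/
def viewMasksM (n : ℕ) (gens words : List (List ℕ)) (M : ℕ) : List ℕ :=
  words.map fun w => wordApplyL n gens w M

/-- **Masked class-table check**: `cls` has length `n`, classes `< |μ|`, and for every view `s < nviews` and qubit
`x < n`, `#{w : x ∈ σ_w(M_s)} = μ[cls x][s]`. (definition) -/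
def multTabOKM (n : ℕ) (gens words : List (List ℕ)) (masks : List ℕ) (nviews : ℕ) (cls : List ℕ)
    (μ : List (List ℕ)) : Bool :=
  (cls.length == n) && ((List.range n).all fun x => decide (cls.getD x 0 < μ.length)) &&
    (List.range nviews).all fun s =>
      (List.range n).all fun x =>
        countMasks (viewMasksM n gens words (masks.getD s 0)) x == (μ.getD (cls.getD x 0) []).getD s 0

/-- **The masked orbit-profile check** of one side: one mask per view, the masked class table, and the landed profile
recursion `profGo` with `q = |words|` and bounds `q · (t_s + 1)`. (definition) -/
def orbitProfileOKM (n wmax : ℕ) (gens words : List (List ℕ)) (masks : List ℕ) (views : List OrbitView)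
    (cls : List ℕ) (μ : List (List ℕ)) : Bool :=
  (masks.length == views.length) && multTabOKM n gens words masks views.length cls μ &&
    profGo μ (classSizes n μ.length cls) wmax 0 (List.replicate views.length 0) (orbBounds words.length views)

/-- **The per-view obligation** of the masked lane: every vector with zero `Hsyn`-syndrome outside the `Hstab` row
space having at most `t` support points inside the column set `M` (bitmask) has weight `> wmax`. (definition, `Prop`) -/
def MaskCovers (n : ℕ) (Hsyn Hstab : List ℕ) (wmax M t : ℕ) : Prop :=
  ∀ z : Fin n → ZMod 2, rowMatrix n Hsyn *ᵥ z = 0 → z ∉ rowSpace (rowMatrix n Hstab) →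
    countB (fun j => M.testBit j) (suppIdx n z) ≤ t → wmax < hammingNorm z

/-! ## 2. Stabilized views -/

/-- One STABILIZED view: an RREF certificate (free columns `I`), the depth `t`, the column set `F ⊇ I` as a bitmask,
orbit labels `orb[x]` (meaningful on `F`), the number of orbits, base points `base[j] ∈ I` and, per qubit `x ∈ F`, a
mover word `mv[x]` in the automorphism generators mapping `x ↦ base[orb x]`. Emitted per view by `emit_stab_row.py`.
(structure) -/
structure StabView where
  /-- RREF certificate of the syndrome rows (qec-search-7 `InfoSetCert`) -/
  ic : InfoSetCert
  /-- depth -/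
  t : ℕ
  /-- the column set `F` (bitmask, `F ⊇` free columns) -/
  mask : ℕ
  /-- orbit label of each qubit -/
  orb : List ℕ
  /-- number of orbit labels -/
  norb : ℕ
  /-- base point (a free column) of each orbit label -/
  base : List ℕ
  /-- mover word of each qubit (letters name generators) -/
  mv : List (List ℕ)

namespace StabView

variable (v : StabView)

/-- The permutation table of the mover of `x`. (definition) -/
def mvTab (n : ℕ) (perms : List (List ℕ)) (x : ℕ) : List ℕ := wordPerm n perms (v.mv.getD x [])

/-- **The mover check of an `F`-column `x`**: its label `j < norb`; the base point `b = base[j]` is a free column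
`< n` with label `j`; the mover table maps `x ↦ b`, preserves membership in `F` of every `y < n` (as a Bool
EQUALITY, so `F` is mapped onto itself) and preserves the labels on `F`. (definition) -/
def moverOK (n : ℕ) (perms : List (List ℕ)) (x : ℕ) : Bool :=
  decide (v.orb.getD x 0 < v.norb) && decide (v.base.getD (v.orb.getD x 0) 0 < n) &&
    !(v.ic.piv.elem (v.base.getD (v.orb.getD x 0) 0)) &&
    (v.orb.getD (v.base.getD (v.orb.getD x 0) 0) 0 == v.orb.getD x 0) &&
    (permFun (v.mvTab n perms x) x == v.base.getD (v.orb.getD x 0) 0) &&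
    (List.range n).all fun y =>
      (v.mask.testBit (permFun (v.mvTab n perms x) y) == v.mask.testBit y) &&
        (!(v.mask.testBit y) || (v.orb.getD (permFun (v.mvTab n perms x) y) 0 == v.orb.getD y 0))

/-- **The structural check of a stabilized view** (besides `infoSetStructOK`): every mover word names generators;
every free column `< n` is in `F`; every `F`-column `< n` passes `moverOK`. (definition, `decide +kernel`) -/
def stabOK (n : ℕ) (perms : List (List ℕ)) (ngens : ℕ) : Bool :=
  autWordsOK ngens v.mv &&
    (List.range n).all fun x =>
      (!(isFree v.ic.piv x) || v.mask.testBit x) && (!(v.mask.testBit x) || v.moverOK n perms x)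

/-- The columns of canonical family `j`: free columns `< n` with label `≥ j`, other than `base[j]`, increasing.
(definition) -/
def canonCols (n : ℕ) (j : ℕ) : List ℕ :=
  (List.range n).filter fun y => !(v.ic.piv.elem y) && decide (j ≤ v.orb.getD y 0) && !(y == v.base.getD j 0)

/-- The rows of canonical family `j`: the kernel-basis words of `canonCols j`. (definition) -/
def canonRows (n : ℕ) (j : ℕ) : List ℕ := (v.canonCols n j).map (kerVec v.ic.piv v.ic.red)

/-- The forced row of canonical family `j`: the kernel-basis word of `base[j]`. (definition) -/
def baseRow (j : ℕ) : ℕ := kerVec v.ic.piv v.ic.red (v.base.getD j 0)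

/-- The plain view (RREF certificate + depth) underlying a stabilized view. (definition) -/
def toView : OrbitView := ⟨v.ic, v.t⟩

end StabView

/-! ## 3. Small facts used by the soundness file -/

/-- `canonCols` entries are `< n`, free, labelled `≥ j`, and differ from `base[j]`. -/
theorem StabView.mem_canonCols (v : StabView) {n j y : ℕ} :
    y ∈ v.canonCols n j ↔ y < n ∧ v.ic.piv.elem y = false ∧ j ≤ v.orb.getD y 0 ∧ y ≠ v.base.getD j 0 := by
  rw [StabView.canonCols, List.mem_filter, List.mem_range]
  constructor
  · rintro ⟨hy, h⟩
    simp only [Bool.and_eq_true, Bool.not_eq_true', decide_eq_true_eq, beq_eq_false_iff_ne] at h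
    exact ⟨hy, h.1.1, h.1.2, h.2⟩
  · rintro ⟨hy, h1, h2, h3⟩
    refine ⟨hy, ?_⟩
    simp only [Bool.and_eq_true, Bool.not_eq_true', decide_eq_true_eq, beq_eq_false_iff_ne]
    exact ⟨⟨h1, h2⟩, h3⟩

/-- Unpacking `stabOK`: the word check, `free ⊆ F`, and the mover check of every `F`-column. -/
theorem StabView.stabOK_spec (v : StabView) {n ngens : ℕ} {perms : List (List ℕ)}
    (h : v.stabOK n perms ngens = true) :
    autWordsOK ngens v.mv = true ∧
      (∀ x, x < n → isFree v.ic.piv x = true → v.mask.testBit x = true) ∧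
      (∀ x, x < n → v.mask.testBit x = true → v.moverOK n perms x = true) := by
  simp only [StabView.stabOK, Bool.and_eq_true, List.all_eq_true, List.mem_range, Bool.or_eq_true,
    Bool.not_eq_true'] at h
  obtain ⟨hw, hall⟩ := h
  refine ⟨hw, fun x hx hf => ?_, fun x hx hm => ?_⟩
  · rcases (hall x hx).1 with h | h
    · rw [hf] at h; exact absurd h (by decide)
    · exact h
  · rcases (hall x hx).2 with h | h
    · rw [hm] at h; exact absurd h (by decide)
    · exact h

/-- Unpacking `moverOK`. -/
theorem StabView.moverOK_spec (v : StabView) {n : ℕ} {perms : List (List ℕ)} {x : ℕ}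
    (h : v.moverOK n perms x = true) :
    v.orb.getD x 0 < v.norb ∧ v.base.getD (v.orb.getD x 0) 0 < n ∧
      v.ic.piv.elem (v.base.getD (v.orb.getD x 0) 0) = false ∧
      v.orb.getD (v.base.getD (v.orb.getD x 0) 0) 0 = v.orb.getD x 0 ∧
      permFun (v.mvTab n perms x) x = v.base.getD (v.orb.getD x 0) 0 ∧
      (∀ y, y < n → v.mask.testBit (permFun (v.mvTab n perms x) y) = v.mask.testBit y) ∧
      (∀ y, y < n → v.mask.testBit y = true → v.orb.getD (permFun (v.mvTab n perms x) y) 0 = v.orb.getD y 0) := by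
  simp only [StabView.moverOK, Bool.and_eq_true, decide_eq_true_eq, Bool.not_eq_true', beq_iff_eq,
    List.all_eq_true, List.mem_range, Bool.or_eq_true] at h
  obtain ⟨⟨⟨⟨⟨h1, h2⟩, h3⟩, h4⟩, h5⟩, h6⟩ := h
  refine ⟨h1, h2, h3, h4, h5, fun y hy => (h6 y hy).1, fun y hy hm => ?_⟩
  rcases (h6 y hy).2 with h | h
  · rw [hm] at h; exact absurd h (by decide)
  · exact h

/-! ## 4. Controls (`[[4,2,2]]`: one check row `1111`; the data is re-used by the soundness file's end-to-end control) -/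

/-- The stabilized `Z = X` view of the `[[4,2,2]]` control: pivot column `0` (free `1,2,3`, kernel words `γ₁ = 3`,
`γ₂ = 5`, `γ₃ = 9`), depth `1`, `F = {0,1,2,3}` (mask `15`); the subgroup `H = {id, q ↦ q+2}` of the cyclic shifts has
orbits `{1,3}` (label `0`, base `1`) and `{0,2}` (label `1`, base `2`); movers: `q ↦ q+2` (word `[0,0]` in the shift
`q ↦ q+1`) for `x = 0, 3`, the identity for `x = 1, 2`. (definition) -/
def stabC422 : StabView where
  ic := ⟨[0], [15], [[0]]⟩
  t := 1
  mask := 15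
  orb := [1, 0, 1, 0]
  norb := 2
  base := [1, 2]
  mv := [[0, 0], [], [], [0, 0]]

/-- The structural check of the control view passes (generator table `[1,2,3,0]` = the shift `q ↦ q+1`). -/
theorem stabC422_ok : stabC422.stabOK 4 [[1, 2, 3, 0]] 1 = true := by decide

/-- NEGATIVE control: with a wrong base point (`base[0] := 3`, so the mover of `x = 1` no longer maps it to its base)
the structural check FAILS. -/
theorem stabC422_neg : ({ stabC422 with base := [3, 2] } : StabView).stabOK 4 [[1, 2, 3, 0]] 1 = false := by decide

/-- The canonical families of the control: family `0` = rows `[γ₂, γ₃] = [5, 9]` with forced row `γ₁ = 3`; family `1`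
= no rows with forced row `γ₂ = 5`. -/
theorem stabC422_families : stabC422.canonRows 4 0 = [5, 9] ∧ stabC422.baseRow 0 = 3 ∧
    stabC422.canonRows 4 1 = [] ∧ stabC422.baseRow 1 = 5 := by decide

/-- The masked profile check of the control passes at `wmax = 1` with the four shifts as words, ONE view at depth
`1` and mask `15`: every qubit has multiplicity `4 < 4 · (1 + 1)`. -/
theorem stabC422_prof :
    orbitProfileOKM 4 1 [[1, 2, 3, 0]] [[], [0], [0, 0], [0, 0, 0]] [15] [stabC422.toView] [0, 0, 0, 0] [[4]]
      = true := by
  decide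

/-- NEGATIVE control: the same data at depth `0` is REJECTED (`4 ≥ 4 · (0 + 1)`). -/
theorem stabC422_prof_neg :
    orbitProfileOKM 4 1 [[1, 2, 3, 0]] [[], [0], [0, 0], [0, 0, 0]] [15] [⟨stabC422.ic, 0⟩] [0, 0, 0, 0] [[4]]
      = false := by
  decide

/-- Both canonical families of the control pass the lane engine as one plain segment each (qec-type-01
`Plane.topReaches_of_seg`): `γ₁ ⊕ (≤ 0 of [γ₂, γ₃])` and `γ₂` alone have weight `2 > 1`. -/
theorem stabC422_top :
    TopReaches (bzLeaf 1 []) (stabC422.canonRows 4 0) (stabC422.baseRow 0) 0 ∧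
      TopReaches (bzLeaf 1 []) (stabC422.canonRows 4 1) (stabC422.baseRow 1) 0 :=
  ⟨Plane.topReaches_of_seg 4 1 [] _ _ 0 1 (by decide) (by decide),
    Plane.topReaches_of_seg 4 1 [] _ _ 0 1 (by decide) (by decide)⟩

end Summit.Ventures.QEC.Census
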